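import Mathlib
import HarnessLib
import Summits.NavierStokesRegularity.NavierStokesRegularity.Theorems.HalfSpaceWindowDoorCirculationCarryingRigidityDefs
import Summits.NavierStokesRegularity.NavierStokesRegularity.Theorems.HalfSpaceWindowDoorCirculationCarryingRigidityRotHeadLiouville
import Summits.NavierStokesRegularity.NavierStokesRegularity.Theorems.HalfSpaceWindowDoorCirculationCarryingRigidityAsymptoticPlanarity
import Summits.NavierStokesRegularity.NavierStokesRegularity.Theorems.PoloidalWindowDoorPoloidalWindowRigidityWindow
import Summits.NavierStokesRegularity.NavierStokesRegularity.Theorems.PoloidalWindowDoorPoloidalWindowRigidityFlat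
import Literature.Analysis.FluidPDE.VorticityCalculus

/-!
# Route `HalfSpaceWindowDoor`, crux `CirculationCarryingRigidity` (stmt-NavierStokesRegularity-25311) — line
# `rot_bernoulli`, IV: CENSUS ROW — the COUNTER-ROTATING ROTATED-SELF-SIMILAR stratum of the closed-hemisphere door
# class is EMPTY

LEAD ns-hsw-p1 g11 (cell pub-ns-dss).  The door-class reading of the Liouville theorem of `…RotHeadLiouville`.  A door-class
profile `v` (`InDoorClass C v`: time rate `C/√(−t)`, continuity, unit-viscosity Oseen–Duhamel identity, divergence-free
slices) is ROTATED SELF-SIMILAR about the vertical axis with angular speed `α` (Pineau–Vicol arXiv:2607.09619 (1.7):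
`v(x,t) = (−t)^{−1/2} R(αs) U(R(−αs)x/√(−t))`, `s = −log(−t)`) exactly when its time `−1` slice `U = v(−1)` solves, with the
similarity pressure `P = p(−1, ·)`, the rotated Leray system (1.8)
`−ΔU + ½U + ½(y·∇)U + (U·∇)U + ∇P + α(e₃×U − ((e₃×y)·∇)U) = 0`, `div U = 0`;
this file takes THAT SYSTEM AT THE SLICE `t = −1` as the definition of the stratum (with a `C²`, polynomially bounded
pressure — for a door-class profile the similarity pressure has bounded gradient, hence linear growth), so no chain rule
for the ansatz is needed, and proves:

* `eq_zero_of_rotProfile_slice` — door class + closed hemisphere `⟪curl v, e₃⟫ ≥ 0` + the slice `v(−1)` is a rotated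
  Leray profile with `α ≤ 0` ⇒ `v ≡ 0` on the slab (`…RotHeadLiouville.exists_eq_const_of_rotProfile_signE3` makes the
  slice constant; ONE translation-invariant slice kills a door-class profile, `…AsymptoticPlanarity.eq_zero_of_lineInvariant_slice`);
* `inner_curl_e3_eq_zero_of_rotProfile_slice`, `not_isBackwardSingularPoint_of_rotProfile_slice`;
* `hemisphereLiouvilleE3_of_rss` — W6 = `HemisphereLiouvilleE3` RESTRICTED to the counter-rotating RSS stratum (hypotheses of
  `HemisphereLiouvilleE3` verbatim + the slice system), `circulationCarryingRigidity_of_rss` — the crux restricted likewise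
  (direction `e₃`; vacuous: the profile is zero);
* `alpha_pos_of_ne_zero` — ENEMY FORM: a non-zero closed-hemisphere door-class profile which is rotated self-similar must
  CO-ROTATE with its vertical vorticity, `α > 0`.

CENSUS READING.  Self-similar profiles (`α = 0`) were already excluded WITHOUT the sign (Tsai 1998, tree
`…PoloidalWindowRigidityStrata.eq_zero_of_selfSimilar`); with the sign, every COUNTER-rotating RSS profile is excluded too, by
a maximum principle for the rotation-corrected Bernoulli function `P + ½|U|² + ½y·U − α(e₃×y)·U` whose defect is exactly
`2αω₃ ≤ 0` (`…RotHead`).  The CO-rotating RSS stratum `α > 0` (pattern rotating WITH the swirl its vorticity induces — the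
physically natural orientation) is NOT excluded by this mechanism (`|Ω|² − 2αΩ₃` is indefinite); Pineau–Vicol's Theorem 1.4
excludes it for `|α| ≪ 1` and `|α| ≫ 1` in the space–time Type-I class, sign-free.

WHAT THIS IS NOT: not a statement about Navier–Stokes regularity (Clay A); the door statements concern HYPOTHETICAL blow-up
profiles (KNSS ancient mild solutions); helper `--supports` 25311; the item stays OPEN at its research stub.
-/

noncomputable section

-- the summit and its single sub-problem share the name (CONVENTIONS §1), as in every Theorems file
set_option linter.dupNamespace false

namespace Summit.NavierStokesRegularity.NavierStokesRegularity.Theorems.HalfSpaceWindowDoorCirculationCarryingRigidityRotHeadCensus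

open Set Function Filter Topology InnerProductSpace
open scoped RealInnerProductSpace Laplacian ContDiff
open Literature.Analysis Literature.Analysis.FluidPDE
open Summit.NavierStokesRegularity.NavierStokesRegularity.Theses.HalfSpaceWindowDoor (CirculationCarryingRigidity)
open Summit.NavierStokesRegularity.NavierStokesRegularity.Theorems.HalfSpaceWindowDoorCirculationCarryingRigidityDefs
  (InDoorClass SignE3 e3 HemisphereLiouvilleE3)
open Summit.NavierStokesRegularity.NavierStokesRegularity.Theorems.HalfSpaceWindowDoorCirculationCarryingRigidityRotHeadLiouville
  (exists_eq_const_of_rotProfile_signE3)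
open Summit.NavierStokesRegularity.NavierStokesRegularity.Theorems.HalfSpaceWindowDoorCirculationCarryingRigidityAsymptoticPlanarity
  (eq_zero_of_lineInvariant_slice)
open Summit.NavierStokesRegularity.NavierStokesRegularity.Theorems.PoloidalWindowDoorPoloidalWindowRigidityWindow
  (isTypeIAncientMild_of_class)
open Summit.NavierStokesRegularity.NavierStokesRegularity.Theorems.PoloidalWindowDoorPoloidalWindowRigidityFlat
  (not_backwardSingular_of_zero)

variable {C : ℝ} {v : ℝ → EuclideanSpace ℝ (Fin 3) → EuclideanSpace ℝ (Fin 3)}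

/-- **The counter-rotating rotated-self-similar stratum of the closed-hemisphere door class is empty.**  Let `v` be a
door-class profile with `⟪curl v(s), e₃⟫ ≥ 0` on the slab, whose time `−1` slice `U = v(−1)` solves the rotated Leray
system `−ΔU + ½U + ½(y·∇)U + (U·∇)U + ∇P + α(e₃×U − ((e₃×y)·∇)U) = 0` with some `C²`, polynomially bounded pressure `P`
and an angular speed `α ≤ 0`.  Then `v ≡ 0` on the slab. -/
theorem eq_zero_of_rotProfile_slice (hv : InDoorClass C v) (hsign : SignE3 v) {α : ℝ} (hα : α ≤ 0)
    {P : EuclideanSpace ℝ (Fin 3) → ℝ} (hP2 : ContDiff ℝ 2 P)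
    (hPpoly : ∃ K : ℝ, ∃ N : ℕ, ∀ y, |P y| ≤ K * (1 + ‖y‖) ^ N)
    (hprof : ∀ y, -((Δ (v (-1))) y) + (1 / 2 : ℝ) • v (-1) y + (1 / 2 : ℝ) • fderiv ℝ (v (-1)) y y +
      convect (v (-1)) (v (-1)) y + gradient P y + α • (rotGen (v (-1) y) - fderiv ℝ (v (-1)) y (rotGen y)) = 0) :
    ∀ t < 0, ∀ x, v t x = 0 := by
  obtain ⟨hrate, hcont, hmild, hdiv⟩ := hv
  have hA : IsTypeIAncientMild C v := isTypeIAncientMild_of_class hrate hcont hmild hdiv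
  have h1 : (-1 : ℝ) < 0 := by norm_num
  set U : EuclideanSpace ℝ (Fin 3) → EuclideanSpace ℝ (Fin 3) := v (-1) with hU
  have hU3 : ContDiff ℝ 3 U := contDiff_infty.1 (hA.contDiff_slice h1) 3
  have hdivU : VectorCalculus.IsDivFree U := hdiv (-1) h1
  have hUbdd : ∃ M : ℝ, ∀ y, ‖U y‖ ≤ M := ⟨C, fun y => by
    have h := hA.norm_le h1 y
    rwa [neg_neg, Real.sqrt_one, div_one] at h⟩
  have hsignU : ∀ y, 0 ≤ curl U y 2 := fun y => by
    have h := hsign (-1) h1 y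
    simpa [e3, EuclideanSpace.inner_single_right] using h
  have he3 : e3 ≠ 0 := fun h => by
    have h2 := congrArg (fun w : EuclideanSpace ℝ (Fin 3) => w 2) h
    simp [e3] at h2
  have heq : ∀ y, -((1 : ℝ) • (Δ U) y) + (1 / 2 : ℝ) • U y + (1 / 2 : ℝ) • fderiv ℝ U y y + convect U U y +
      gradient P y + α • (rotGenL (U y) - fderiv ℝ U y (rotGenL y)) = 0 := fun y => by
    rw [one_smul, rotGenL_apply, rotGenL_apply]
    exact hprof y
  obtain ⟨c, hc⟩ := exists_eq_const_of_rotProfile_signE3 one_pos (by norm_num : (0 : ℝ) < 1 / 2) hU3 hP2 hdivU heq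
    hUbdd hPpoly hα hsignU
  -- a constant slice is translation invariant along `e₃`: ONE invariant slice kills
  exact eq_zero_of_lineInvariant_slice hA h1 he3 fun x θ => by
    change U (x + θ • e3) = U x
    rw [hc, hc]

/-- Hence such a profile is POLOIDAL along `e₃` (indeed zero). -/
theorem inner_curl_e3_eq_zero_of_rotProfile_slice (hv : InDoorClass C v) (hsign : SignE3 v) {α : ℝ} (hα : α ≤ 0)
    {P : EuclideanSpace ℝ (Fin 3) → ℝ} (hP2 : ContDiff ℝ 2 P)
    (hPpoly : ∃ K : ℝ, ∃ N : ℕ, ∀ y, |P y| ≤ K * (1 + ‖y‖) ^ N)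
    (hprof : ∀ y, -((Δ (v (-1))) y) + (1 / 2 : ℝ) • v (-1) y + (1 / 2 : ℝ) • fderiv ℝ (v (-1)) y y +
      convect (v (-1)) (v (-1)) y + gradient P y + α • (rotGen (v (-1) y) - fderiv ℝ (v (-1)) y (rotGen y)) = 0) :
    ∀ s < 0, ∀ y, ⟪curl (v s) y, e3⟫ = 0 := by
  intro s hs y
  have hz : v s = 0 := funext fun x => eq_zero_of_rotProfile_slice hv hsign hα hP2 hPpoly hprof s hs x
  rw [hz, curl_zero]
  simp

/-- … and NOT backward singular at the apex. -/
theorem not_isBackwardSingularPoint_of_rotProfile_slice (hv : InDoorClass C v) (hsign : SignE3 v) {α : ℝ}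
    (hα : α ≤ 0) {P : EuclideanSpace ℝ (Fin 3) → ℝ} (hP2 : ContDiff ℝ 2 P)
    (hPpoly : ∃ K : ℝ, ∃ N : ℕ, ∀ y, |P y| ≤ K * (1 + ‖y‖) ^ N)
    (hprof : ∀ y, -((Δ (v (-1))) y) + (1 / 2 : ℝ) • v (-1) y + (1 / 2 : ℝ) • fderiv ℝ (v (-1)) y y +
      convect (v (-1)) (v (-1)) y + gradient P y + α • (rotGen (v (-1) y) - fderiv ℝ (v (-1)) y (rotGen y)) = 0) :
    ¬ IsBackwardSingularPoint v 0 :=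
  not_backwardSingular_of_zero (eq_zero_of_rotProfile_slice hv hsign hα hP2 hPpoly hprof)

/-- **W6 = `HemisphereLiouvilleE3` RESTRICTED TO THE COUNTER-ROTATING RSS STRATUM** (the hypotheses of `HemisphereLiouvilleE3`
verbatim, plus: the time `−1` slice solves the rotated Leray system with `α ≤ 0` and a `C²`, polynomially bounded
pressure). -/
theorem hemisphereLiouvilleE3_of_rss (C : ℝ) (v : ℝ → EuclideanSpace ℝ (Fin 3) → EuclideanSpace ℝ (Fin 3))
    (hrate : HasTypeITimeDecay C v) (hcont : ContinuousOn (Function.uncurry v) (Set.Iio (0 : ℝ) ×ˢ Set.univ))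
    (hmild : ∀ s t : ℝ, s < t → t < 0 → ∀ x,
      v t x = UnboundedOperators.heatExtension (v s) (t - s) x - oseenDuhamel 1 s v v t x)
    (hdiv : ∀ t < 0, VectorCalculus.IsDivFree (v t)) (hsign : ∀ s < 0, ∀ y, 0 ≤ ⟪curl (v s) y, e3⟫)
    {α : ℝ} (hα : α ≤ 0) {P : EuclideanSpace ℝ (Fin 3) → ℝ} (hP2 : ContDiff ℝ 2 P)
    (hPpoly : ∃ K : ℝ, ∃ N : ℕ, ∀ y, |P y| ≤ K * (1 + ‖y‖) ^ N)
    (hprof : ∀ y, -((Δ (v (-1))) y) + (1 / 2 : ℝ) • v (-1) y + (1 / 2 : ℝ) • fderiv ℝ (v (-1)) y y +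
      convect (v (-1)) (v (-1)) y + gradient P y + α • (rotGen (v (-1) y) - fderiv ℝ (v (-1)) y (rotGen y)) = 0) :
    ∀ s < 0, ∀ y, ⟪curl (v s) y, e3⟫ = 0 :=
  inner_curl_e3_eq_zero_of_rotProfile_slice ⟨hrate, hcont, hmild, hdiv⟩ hsign hα hP2 hPpoly hprof

/-- **The crux `CirculationCarryingRigidity` RESTRICTED TO THE COUNTER-ROTATING RSS STRATUM**, direction `e₃` (the hypotheses
of the route decl at `e = e₃` verbatim, plus the slice system with `α ≤ 0`): vacuous — the profile is zero, so no slice has a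
point of strictly positive `⟪curl v(s)(y), e₃⟫`. -/
theorem circulationCarryingRigidity_of_rss (C : ℝ) (v : ℝ → EuclideanSpace ℝ (Fin 3) → EuclideanSpace ℝ (Fin 3))
    (hrate : HasTypeITimeDecay C v) (hcont : ContinuousOn (Function.uncurry v) (Set.Iio (0 : ℝ) ×ˢ Set.univ))
    (hmild : ∀ s t : ℝ, s < t → t < 0 → ∀ x,
      v t x = UnboundedOperators.heatExtension (v s) (t - s) x - oseenDuhamel 1 s v v t x)
    (hdiv : ∀ t < 0, VectorCalculus.IsDivFree (v t)) (hsign : ∀ s < 0, ∀ y, 0 ≤ ⟪curl (v s) y, e3⟫)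
    (hpos : ∃ s, s < 0 ∧ ∃ y, 0 < ⟪curl (v s) y, e3⟫)
    {α : ℝ} (hα : α ≤ 0) {P : EuclideanSpace ℝ (Fin 3) → ℝ} (hP2 : ContDiff ℝ 2 P)
    (hPpoly : ∃ K : ℝ, ∃ N : ℕ, ∀ y, |P y| ≤ K * (1 + ‖y‖) ^ N)
    (hprof : ∀ y, -((Δ (v (-1))) y) + (1 / 2 : ℝ) • v (-1) y + (1 / 2 : ℝ) • fderiv ℝ (v (-1)) y y +
      convect (v (-1)) (v (-1)) y + gradient P y + α • (rotGen (v (-1) y) - fderiv ℝ (v (-1)) y (rotGen y)) = 0) :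
    ¬ IsBackwardSingularPoint v 0 := by
  obtain ⟨s, hs, y, hy⟩ := hpos
  have h0 := inner_curl_e3_eq_zero_of_rotProfile_slice ⟨hrate, hcont, hmild, hdiv⟩ hsign hα hP2 hPpoly hprof s hs y
  rw [h0] at hy
  exact absurd hy (lt_irrefl 0)

/-- **ENEMY FORM: an enemy of W6 that is rotated self-similar CO-ROTATES.**  If a closed-hemisphere door-class profile with a
non-zero value has a time `−1` slice solving the rotated Leray system with angular speed `α` (and a `C²`, polynomially
bounded pressure), then `α > 0`: the pattern rotates in the sense of the swirl induced by its (non-negative) vertical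
vorticity. -/
theorem alpha_pos_of_ne_zero (hv : InDoorClass C v) (hsign : SignE3 v) (hne : ∃ t < 0, ∃ x, v t x ≠ 0) {α : ℝ}
    {P : EuclideanSpace ℝ (Fin 3) → ℝ} (hP2 : ContDiff ℝ 2 P)
    (hPpoly : ∃ K : ℝ, ∃ N : ℕ, ∀ y, |P y| ≤ K * (1 + ‖y‖) ^ N)
    (hprof : ∀ y, -((Δ (v (-1))) y) + (1 / 2 : ℝ) • v (-1) y + (1 / 2 : ℝ) • fderiv ℝ (v (-1)) y y +
      convect (v (-1)) (v (-1)) y + gradient P y + α • (rotGen (v (-1) y) - fderiv ℝ (v (-1)) y (rotGen y)) = 0) :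
    0 < α := by
  by_contra hle
  push Not at hle
  obtain ⟨t, ht, x, hx⟩ := hne
  exact hx (eq_zero_of_rotProfile_slice hv hsign hle hP2 hPpoly hprof t ht x)

end Summit.NavierStokesRegularity.NavierStokesRegularity.Theorems.HalfSpaceWindowDoorCirculationCarryingRigidityRotHeadCensus

end
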